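import Summits.FinalStateConjecture.FinalStateConjecture.Theorems.EIHFluxBalanceInertialRecessionStubCoerSymbolQuantNullPair
import Summits.FinalStateConjecture.FinalStateConjecture.Theorems.EIHFluxBalanceInertialRecessionStubCoerSymbolQuantAxis

/-!
# Route EIHFluxBalance — `InertialRecession` (E′), line `SketchCleanExcision`, skeleton r13,
# stub `stub_coerSymbolQuant` (C): the COMPACTNESS ARGUMENT for the symbol rows (normalised data)

Helper file for the crux `stmt-FinalStateConjecture-17403`
(`Summit.FinalStateConjecture.FinalStateConjecture.Theses.EIHFluxBalance.InertialRecession`, E′),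
registered stub `stub_coerSymbolQuant` (quantitative uniform robust COER-B). Notation of the memo:
`S = Λ⁻¹`, `Var(S,A,d)(x) = Dg(Sx)(A(Sx) + d)(S·,S·) + g(Sx)(AS·,S·) + g(Sx)(S·,AS·)` the lab
first-variation form of the painted summand `K = g(Sx)(S·,S·)` (`g = Kerr.bilin M a`) under the
infinitesimal rest-frame Poincaré motion `z ↦ Az + d`, and
`2σ_B(dx⁰)[V](Y,Z) = dx⁰(Z)dx⁰(B⁻¹V(·,Y)) + dx⁰(Y)V(B⁻¹dx⁰,Z) − dx⁰(B⁻¹dx⁰)V(Y,Z) − dx⁰(Y)dx⁰(Z) tr(B⁻¹∘Vᵗ)`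
twice the principal-symbol rows of `ricAt_apply_eq_add_symbol_of_jets` (written out in full in the
statements below; no definitions).

* `coerSym_continuousAt_var`, `coerSym_continuousAt_symbolBV`, `coerSym_continuousAt_symbol`,
  `coerSym_continuousAt_K` — joint continuity of `Var`, of the rows, and of `K` in
  `(B, S, A, d)` at every parameter with `r(Sx) > 0` and `B` invertible (`fun_prop`; inversion is
  smooth at invertible maps, `Kerr.bilin` is smooth off the singular set);
* `coerSym_continuous_red`, `coerSym_isClosed_skew` — bookkeeping for the compact parameter set
  `isCompact_lorentzBounded γ × (skew ∩ ball) × ball`;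
* `coerSym_core_normalised` — **the compactness argument**: along painted frames `Λₙ`
  (`|(Λₙe₀)⁰| ≤ γ`), skew `Aₙ`, `dₙ` with bounded norms and reduced size
  `‖Aₙe₀‖ + ‖d⃗ₙ‖ + ‖a Aₙe₃‖ = 1`, and shell values `Bₙ(y)` with `‖Bₙ(y) − K_{Λₙ}(0,y)‖ ≤ εₙ → 0`,
  the rows `2σ_{Bₙ(y)}(dx⁰)[Varₙ(0,y)]` cannot be `O(εₙ)` on the whole lab shell: a subsequence of
  `(Λₙ⁻¹, Aₙ, dₙ)` converges (`IsCompact.tendsto_subseq`), the rows pass to the limit and vanish on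
  the shell, hence at the three lab axis events (`coerSym_axis_event`), and
  `coerSym_axisKernel_of_symbol` forces reduced size `0 ≠ 1`.

Elementary topology; no definitions, no named facts, no `sorry`.
-/

set_option linter.dupNamespace false
set_option maxSynthPendingDepth 3

noncomputable section

open Set Function Metric Filter Literature.Geometry.Lorentzian Literature.Geometry.Lorentzian.MetricCoord
  Summit.FinalStateConjecture.FinalStateConjecture.Theorems
open scoped Topology

namespace Summit.FinalStateConjecture.FinalStateConjecture.Theorems.SublinearIsFree.Slaving

/-! ### Continuity of the symbol rows in all parameters -/

section Continuity

/-- `flip` is continuous (fed to `fun_prop` as a local hypothesis below). [folklore] -/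
theorem coerSym_continuous_flip {E F G : Type*} [NormedAddCommGroup E] [NormedSpace ℝ E]
    [NormedAddCommGroup F] [NormedSpace ℝ F] [NormedAddCommGroup G] [NormedSpace ℝ G] :
    Continuous fun f : E →L[ℝ] F →L[ℝ] G ↦ f.flip :=
  (ContinuousLinearMap.flipₗᵢ ℝ E F G).continuous

/-- **`Var` is jointly continuous in `(S, A, d)`** (and a dummy form slot) at every parameter whose
rest image `S x` has `r > 0` (`Kerr.bilin` is `C^∞` there, `isMetricOn_kerr_bilin`). [folklore] -/
theorem coerSym_continuousAt_var (M a : ℝ) (x : E4)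
    (p₀ : (E4 →L[ℝ] E4 →L[ℝ] ℝ) × (E4 →L[ℝ] E4) × (E4 →L[ℝ] E4) × E4) (hr : 0 < Kerr.radius a (p₀.2.1 x)) :
    ContinuousAt (fun p : (E4 →L[ℝ] E4 →L[ℝ] ℝ) × (E4 →L[ℝ] E4) × (E4 →L[ℝ] E4) × E4 ↦
      (ContinuousLinearMap.bilinearComp (fderiv ℝ (Kerr.bilin M a) (p.2.1 x) (p.2.2.1 (p.2.1 x) + p.2.2.2)) p.2.1 p.2.1 + ContinuousLinearMap.bilinearComp (Kerr.bilin M a (p.2.1 x)) (ContinuousLinearMap.comp p.2.2.1 p.2.1) p.2.1 + ContinuousLinearMap.bilinearComp (Kerr.bilin M a (p.2.1 x)) p.2.1 (ContinuousLinearMap.comp p.2.2.1 p.2.1))) p₀ := by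
  have hx' : p₀.2.1 x ∈ (Kerr.region a 0 : Set E4) := by
    rw [SetLike.mem_coe, Kerr.mem_region, max_self]; exact hr
  have h1 : ContinuousAt (fderiv ℝ (Kerr.bilin M a)) (p₀.2.1 x) :=
    ((isMetricOn_kerr_bilin M a).contDiffAt_fderiv hx').continuousAt
  have h2 : ContinuousAt (Kerr.bilin M a) (p₀.2.1 x) := (Kerr.contDiffAt_bilin M a hr (n := 0)).continuousAt
  have hflip : Continuous fun f : E4 →L[ℝ] E4 →L[ℝ] ℝ ↦ f.flip := coerSym_continuous_flip
  unfold ContinuousLinearMap.bilinearComp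
  fun_prop

/-- **The symbol rows are jointly continuous in `(B, V)`** at every invertible value `B` (inversion
is smooth at invertible maps). [folklore] -/
theorem coerSym_continuousAt_symbolBV (Y Z : E4) (q₀ : (E4 →L[ℝ] E4 →L[ℝ] ℝ) × (E4 →L[ℝ] E4 →L[ℝ] ℝ))
    (hB : q₀.1.IsInvertible) :
    ContinuousAt (fun q : (E4 →L[ℝ] E4 →L[ℝ] ℝ) × (E4 →L[ℝ] E4 →L[ℝ] ℝ) ↦ (E4.dx 0 Z * E4.dx 0 (ContinuousLinearMap.inverse q.1 (ContinuousLinearMap.flip q.2 Y)) + E4.dx 0 Y * q.2 (ContinuousLinearMap.inverse q.1 (E4.dx 0)) Z - E4.dx 0 (ContinuousLinearMap.inverse q.1 (E4.dx 0)) * q.2 Y Z - E4.dx 0 Y * E4.dx 0 Z * MetricCoord.traceCLM E4 (ContinuousLinearMap.comp (ContinuousLinearMap.inverse q.1) (ContinuousLinearMap.flip q.2)))) q₀ := by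
  have h1 : ContinuousAt (fun B : E4 →L[ℝ] E4 →L[ℝ] ℝ ↦ B.inverse) q₀.1 :=
    (hB.contDiffAt_map_inverse (n := 0)).continuousAt
  have hflip : Continuous fun f : E4 →L[ℝ] E4 →L[ℝ] ℝ ↦ f.flip := coerSym_continuous_flip
  fun_prop

/-- **The symbol rows of `Var` are jointly continuous in `(B, S, A, d)`.** [folklore] -/
theorem coerSym_continuousAt_symbol (M a : ℝ) (x Y Z : E4)
    (p₀ : (E4 →L[ℝ] E4 →L[ℝ] ℝ) × (E4 →L[ℝ] E4) × (E4 →L[ℝ] E4) × E4)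
    (hB : p₀.1.IsInvertible) (hr : 0 < Kerr.radius a (p₀.2.1 x)) :
    ContinuousAt (fun p : (E4 →L[ℝ] E4 →L[ℝ] ℝ) × (E4 →L[ℝ] E4) × (E4 →L[ℝ] E4) × E4 ↦
      (E4.dx 0 Z * E4.dx 0 (ContinuousLinearMap.inverse p.1 (ContinuousLinearMap.flip (ContinuousLinearMap.bilinearComp (fderiv ℝ (Kerr.bilin M a) (p.2.1 x) (p.2.2.1 (p.2.1 x) + p.2.2.2)) p.2.1 p.2.1 + ContinuousLinearMap.bilinearComp (Kerr.bilin M a (p.2.1 x)) (ContinuousLinearMap.comp p.2.2.1 p.2.1) p.2.1 + ContinuousLinearMap.bilinearComp (Kerr.bilin M a (p.2.1 x)) p.2.1 (ContinuousLinearMap.comp p.2.2.1 p.2.1)) Y)) + E4.dx 0 Y * (ContinuousLinearMap.bilinearComp (fderiv ℝ (Kerr.bilin M a) (p.2.1 x) (p.2.2.1 (p.2.1 x) + p.2.2.2)) p.2.1 p.2.1 + ContinuousLinearMap.bilinearComp (Kerr.bilin M a (p.2.1 x)) (ContinuousLinearMap.comp p.2.2.1 p.2.1) p.2.1 + ContinuousLinearMap.bilinearComp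 (Kerr.bilin M a (p.2.1 x)) p.2.1 (ContinuousLinearMap.comp p.2.2.1 p.2.1)) (ContinuousLinearMap.inverse p.1 (E4.dx 0)) Z - E4.dx 0 (ContinuousLinearMap.inverse p.1 (E4.dx 0)) * (ContinuousLinearMap.bilinearComp (fderiv ℝ (Kerr.bilin M a) (p.2.1 x) (p.2.2.1 (p.2.1 x) + p.2.2.2)) p.2.1 p.2.1 + ContinuousLinearMap.bilinearComp (Kerr.bilin M a (p.2.1 x)) (ContinuousLinearMap.comp p.2.2.1 p.2.1) p.2.1 + ContinuousLinearMap.bilinearComp (Kerr.bilin M a (p.2.1 x)) p.2.1 (ContinuousLinearMap.comp p.2.2.1 p.2.1)) Y Z - E4.dx 0 Y * E4.dx 0 Z * MetricCoord.traceCLM E4 (ContinuousLinearMap.comp (ContinuousLinearMap.inverse p.1) (ContinuousLinearMap.flip (ContinuousLinearMap.bilinearComp (fderiv ℝ (Kerr.bilin M a) (p.2.1 x) (p.2.2.1 (p.2.1 x) + p.2.2.2)) p.2.1 p.2.1 + ContinuousLinearMap.bilinearComp (Kerr.bilin M a (p.2.1 x)) (ContinuousLinearMap.comp p.2.2.1 p.2.1)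 p.2.1 + ContinuousLinearMap.bilinearComp (Kerr.bilin M a (p.2.1 x)) p.2.1 (ContinuousLinearMap.comp p.2.2.1 p.2.1)))))) p₀ := by
  have hV := coerSym_continuousAt_var M a x p₀ hr
  have hΨ : ContinuousAt (fun p : (E4 →L[ℝ] E4 →L[ℝ] ℝ) × (E4 →L[ℝ] E4) × (E4 →L[ℝ] E4) × E4 ↦
      (p.1, (ContinuousLinearMap.bilinearComp (fderiv ℝ (Kerr.bilin M a) (p.2.1 x) (p.2.2.1 (p.2.1 x) + p.2.2.2)) p.2.1 p.2.1 + ContinuousLinearMap.bilinearComp (Kerr.bilin M a (p.2.1 x)) (ContinuousLinearMap.comp p.2.2.1 p.2.1) p.2.1 + ContinuousLinearMap.bilinearComp (Kerr.bilin M a (p.2.1 x)) p.2.1 (ContinuousLinearMap.comp p.2.2.1 p.2.1)))) p₀ := continuousAt_fst.prodMk hV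
  have hg := coerSym_continuousAt_symbolBV Y Z (p₀.1, (ContinuousLinearMap.bilinearComp (fderiv ℝ (Kerr.bilin M a) (p₀.2.1 x) (p₀.2.2.1 (p₀.2.1 x) + p₀.2.2.2)) p₀.2.1 p₀.2.1 + ContinuousLinearMap.bilinearComp (Kerr.bilin M a (p₀.2.1 x)) (ContinuousLinearMap.comp p₀.2.2.1 p₀.2.1) p₀.2.1 + ContinuousLinearMap.bilinearComp (Kerr.bilin M a (p₀.2.1 x)) p₀.2.1 (ContinuousLinearMap.comp p₀.2.2.1 p₀.2.1))) hB
  exact ContinuousAt.comp (f := fun p : (E4 →L[ℝ] E4 →L[ℝ] ℝ) × (E4 →L[ℝ] E4) × (E4 →L[ℝ] E4) × E4 ↦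
    (p.1, (ContinuousLinearMap.bilinearComp (fderiv ℝ (Kerr.bilin M a) (p.2.1 x) (p.2.2.1 (p.2.1 x) + p.2.2.2)) p.2.1 p.2.1 + ContinuousLinearMap.bilinearComp (Kerr.bilin M a (p.2.1 x)) (ContinuousLinearMap.comp p.2.2.1 p.2.1) p.2.1 + ContinuousLinearMap.bilinearComp (Kerr.bilin M a (p.2.1 x)) p.2.1 (ContinuousLinearMap.comp p.2.2.1 p.2.1)))) hg hΨ

/-- The painted summand at a lab point as a function of `S = Λ⁻¹`: `K = g(Sx)(S·, S·)`. [folklore] -/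
theorem coerSym_boostedKerrBilin_eq (Λ : lorentzGroup) (M a : ℝ) (x : E4) :
    boostedKerrBilin Λ 0 M a x =
      (Kerr.bilin M a ((((Λ : E4 ≃L[ℝ] E4).symm : E4 →L[ℝ] E4)) x)).bilinearComp
        (((Λ : E4 ≃L[ℝ] E4).symm : E4 →L[ℝ] E4)) (((Λ : E4 ≃L[ℝ] E4).symm : E4 →L[ℝ] E4)) := by
  ext v w
  rw [boostedKerrBilin_apply, ContinuousLinearMap.bilinearComp_apply, coerSym_poincareInv_zero]
  rfl

/-- `S ↦ g(Sx)(S·, S·)` is continuous at every `S` with `r(Sx) > 0`. [folklore] -/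
theorem coerSym_continuousAt_K (M a : ℝ) (x : E4) (S₀ : E4 →L[ℝ] E4) (hr : 0 < Kerr.radius a (S₀ x)) :
    ContinuousAt (fun S : E4 →L[ℝ] E4 ↦ (Kerr.bilin M a (S x)).bilinearComp S S) S₀ := by
  have h2 : ContinuousAt (Kerr.bilin M a) (S₀ x) := (Kerr.contDiffAt_bilin M a hr (n := 0)).continuousAt
  have hflip : Continuous fun f : E4 →L[ℝ] E4 →L[ℝ] ℝ ↦ f.flip := coerSym_continuous_flip
  unfold ContinuousLinearMap.bilinearComp
  fun_prop

/-- The reduced size is continuous in `(A, d)`. [folklore] -/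
theorem coerSym_continuous_red (a : ℝ) :
    Continuous fun q : (E4 →L[ℝ] E4) × E4 ↦ (‖q.1 (E4.basisVector 0)‖ + ‖E4.spatial q.2‖ + ‖a • q.1 (E4.basisVector 3)‖) := by
  fun_prop

/-- The `η`-skew operators form a closed set. [folklore] -/
theorem coerSym_isClosed_skew :
    IsClosed {T : E4 →L[ℝ] E4 | ∀ u w : E4, Minkowski.bilin (T u) w + Minkowski.bilin u (T w) = 0} := by
  have hset : {T : E4 →L[ℝ] E4 | ∀ u w : E4, Minkowski.bilin (T u) w + Minkowski.bilin u (T w) = 0} =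
      ⋂ u : E4, ⋂ w : E4, {T : E4 →L[ℝ] E4 | Minkowski.bilin (T u) w + Minkowski.bilin u (T w) = 0} := by
    ext T; simp only [Set.mem_setOf_eq, Set.mem_iInter]
  rw [hset]
  refine isClosed_iInter fun u ↦ isClosed_iInter fun w ↦ isClosed_eq ?_ continuous_const
  fun_prop

end Continuity

/-! ### The compactness argument -/

section Core

/-- **The compactness argument (normalised data).** Along a sequence of painted frames `Λₙ` with
`|(Λₙe₀)⁰| ≤ γ`, skew `Aₙ` and `dₙ` with `‖Aₙ‖, ‖dₙ‖ ≤ C` and reduced size `red = 1`, and values `Bₙ(y)`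
on the lab shell `ρin ≤ ‖y‖ ≤ ρout` with `‖Bₙ(y) − K_{Λₙ}(0,y)‖ ≤ εₙ → 0`, the symbol rows
`σ_{Bₙ(y)}(dx⁰)[Varₙ(0,y)]` cannot be `O(εₙ)` on the whole shell: a subsequence of the parameters
converges in the compact set `isCompact_lorentzBounded × balls` (`IsCompact.tendsto_subseq`), the
rows pass to the limit by continuity (`coerSym_continuousAt_symbol`), vanish there on the whole
shell, hence at the three lab axis events (`coerSym_axis_event`), and the kernel step
`coerSym_axisKernel_of_symbol` forces `red = 0 ≠ 1`. [folklore] -/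
theorem coerSym_core_normalised {M a γ ρin ρout z C : ℝ} (hM : M ≠ 0) (hρ : |a| + 1 ≤ ρin)
    (hz : 0 < z) (hza : 3 * |a| ≤ z) (hzin : (1 + 3 * γ) * ρin ≤ z) (hzout : 4 * (1 + 3 * γ) * z ≤ ρout)
    {ε : ℕ → ℝ} (hε : Tendsto ε atTop (𝓝 0))
    (Λ : ℕ → lorentzGroup) (A : ℕ → E4 →L[ℝ] E4) (d : ℕ → E4) (B : ℕ → E3 → E4 →L[ℝ] E4 →L[ℝ] ℝ)
    (hΛ : ∀ n, |((Λ n : E4 ≃L[ℝ] E4) (E4.basisVector 0)) 0| ≤ γ)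
    (hA : ∀ n (u w : E4), Minkowski.bilin (A n u) w + Minkowski.bilin u (A n w) = 0)
    (hAC : ∀ n, ‖A n‖ ≤ C) (hdC : ∀ n, ‖d n‖ ≤ C) (hred : ∀ n, (‖(A n) (E4.basisVector 0)‖ + ‖E4.spatial (d n)‖ + ‖a • (A n) (E4.basisVector 3)‖) = 1)
    (hB : ∀ n (y : E3), ρin ≤ ‖y‖ → ‖y‖ ≤ ρout →
      ‖B n y - boostedKerrBilin (Λ n) 0 M a (E4.ofTimeSpace 0 y)‖ ≤ ε n)
    (hσ : ∀ n (y : E3), ρin ≤ ‖y‖ → ‖y‖ ≤ ρout → ∀ Y Z : E4,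
      |(E4.dx 0 Z * E4.dx 0 (ContinuousLinearMap.inverse (B n y) (ContinuousLinearMap.flip (ContinuousLinearMap.bilinearComp (fderiv ℝ (Kerr.bilin M a) ((((Λ n : E4 ≃L[ℝ] E4).symm : E4 →L[ℝ] E4)) (E4.ofTimeSpace 0 y)) ((A n) ((((Λ n : E4 ≃L[ℝ] E4).symm : E4 →L[ℝ] E4)) (E4.ofTimeSpace 0 y)) + (d n))) (((Λ n : E4 ≃L[ℝ] E4).symm : E4 →L[ℝ] E4)) (((Λ n : E4 ≃L[ℝ] E4).symm : E4 →L[ℝ] E4)) + ContinuousLinearMap.bilinearComp (Kerr.bilin M a ((((Λ n : E4 ≃L[ℝ] E4).symm : E4 →L[ℝ] E4)) (E4.ofTimeSpace 0 y))) (ContinuousLinearMap.comp (A n) (((Λ n : E4 ≃L[ℝ] E4).symm : E4 →L[ℝ] E4))) (((Λ n : E4 ≃L[ℝ] E4).symm : E4 →L[ℝ] E4)) + ContinuousLinearMap.bilinearComp (Kerr.bilin M a ((((Λ n : E4 ≃L[ℝ] E4).symm : E4 →L[ℝ] E4)) (E4.ofTimeSpace 0 y))) (((Λ n : E4 ≃L[ℝ]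 E4).symm : E4 →L[ℝ] E4)) (ContinuousLinearMap.comp (A n) (((Λ n : E4 ≃L[ℝ] E4).symm : E4 →L[ℝ] E4)))) Y)) + E4.dx 0 Y * (ContinuousLinearMap.bilinearComp (fderiv ℝ (Kerr.bilin M a) ((((Λ n : E4 ≃L[ℝ] E4).symm : E4 →L[ℝ] E4)) (E4.ofTimeSpace 0 y)) ((A n) ((((Λ n : E4 ≃L[ℝ] E4).symm : E4 →L[ℝ] E4)) (E4.ofTimeSpace 0 y)) + (d n))) (((Λ n : E4 ≃L[ℝ] E4).symm : E4 →L[ℝ] E4)) (((Λ n : E4 ≃L[ℝ] E4).symm : E4 →L[ℝ] E4)) + ContinuousLinearMap.bilinearComp (Kerr.bilin M a ((((Λ n : E4 ≃L[ℝ] E4).symm : E4 →L[ℝ] E4)) (E4.ofTimeSpace 0 y))) (ContinuousLinearMap.comp (A n) (((Λ n : E4 ≃L[ℝ] E4).symm : E4 →L[ℝ] E4))) (((Λ n : E4 ≃L[ℝ] E4).symm : E4 →L[ℝ] E4)) + ContinuousLinearMap.bilinearComp (Kerr.bilin M a ((((Λ n : E4 ≃L[ℝ] E4).symm : E4 →L[ℝ]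 E4)) (E4.ofTimeSpace 0 y))) (((Λ n : E4 ≃L[ℝ] E4).symm : E4 →L[ℝ] E4)) (ContinuousLinearMap.comp (A n) (((Λ n : E4 ≃L[ℝ] E4).symm : E4 →L[ℝ] E4)))) (ContinuousLinearMap.inverse (B n y) (E4.dx 0)) Z - E4.dx 0 (ContinuousLinearMap.inverse (B n y) (E4.dx 0)) * (ContinuousLinearMap.bilinearComp (fderiv ℝ (Kerr.bilin M a) ((((Λ n : E4 ≃L[ℝ] E4).symm : E4 →L[ℝ] E4)) (E4.ofTimeSpace 0 y)) ((A n) ((((Λ n : E4 ≃L[ℝ] E4).symm : E4 →L[ℝ] E4)) (E4.ofTimeSpace 0 y)) + (d n))) (((Λ n : E4 ≃L[ℝ] E4).symm : E4 →L[ℝ] E4)) (((Λ n : E4 ≃L[ℝ] E4).symm : E4 →L[ℝ] E4)) + ContinuousLinearMap.bilinearComp (Kerr.bilin M a ((((Λ n : E4 ≃L[ℝ] E4).symm : E4 →L[ℝ] E4)) (E4.ofTimeSpace 0 y))) (ContinuousLinearMap.comp (A n) (((Λ n : E4 ≃L[ℝ] E4).symm : E4 →L[ℝ] E4))) (((Λ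 n : E4 ≃L[ℝ] E4).symm : E4 →L[ℝ] E4)) + ContinuousLinearMap.bilinearComp (Kerr.bilin M a ((((Λ n : E4 ≃L[ℝ] E4).symm : E4 →L[ℝ] E4)) (E4.ofTimeSpace 0 y))) (((Λ n : E4 ≃L[ℝ] E4).symm : E4 →L[ℝ] E4)) (ContinuousLinearMap.comp (A n) (((Λ n : E4 ≃L[ℝ] E4).symm : E4 →L[ℝ] E4)))) Y Z - E4.dx 0 Y * E4.dx 0 Z * MetricCoord.traceCLM E4 (ContinuousLinearMap.comp (ContinuousLinearMap.inverse (B n y)) (ContinuousLinearMap.flip (ContinuousLinearMap.bilinearComp (fderiv ℝ (Kerr.bilin M a) ((((Λ n : E4 ≃L[ℝ] E4).symm : E4 →L[ℝ] E4)) (E4.ofTimeSpace 0 y)) ((A n) ((((Λ n : E4 ≃L[ℝ] E4).symm : E4 →L[ℝ] E4)) (E4.ofTimeSpace 0 y)) + (d n))) (((Λ n : E4 ≃L[ℝ] E4).symm : E4 →L[ℝ] E4)) (((Λ n : E4 ≃L[ℝ] E4).symm : E4 →L[ℝ] E4)) + ContinuousLinearMap.bilinearComp (Kerr.bilin M a ((((Λ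 n : E4 ≃L[ℝ] E4).symm : E4 →L[ℝ] E4)) (E4.ofTimeSpace 0 y))) (ContinuousLinearMap.comp (A n) (((Λ n : E4 ≃L[ℝ] E4).symm : E4 →L[ℝ] E4))) (((Λ n : E4 ≃L[ℝ] E4).symm : E4 →L[ℝ] E4)) + ContinuousLinearMap.bilinearComp (Kerr.bilin M a ((((Λ n : E4 ≃L[ℝ] E4).symm : E4 →L[ℝ] E4)) (E4.ofTimeSpace 0 y))) (((Λ n : E4 ≃L[ℝ] E4).symm : E4 →L[ℝ] E4)) (ContinuousLinearMap.comp (A n) (((Λ n : E4 ≃L[ℝ] E4).symm : E4 →L[ℝ] E4)))))))| ≤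
        ε n * ‖Y‖ * ‖Z‖) :
    False := by
  have hγ0 : 0 ≤ γ := (abs_nonneg _).trans (hΛ 0)
  -- the compact parameter set and the convergent subsequence
  let 𝒦 : Set ((E4 →L[ℝ] E4) × (E4 →L[ℝ] E4) × E4) :=
    {L : E4 →L[ℝ] E4 | (∀ v w, Minkowski.bilin (L v) (L w) = Minkowski.bilin v w) ∧
      |L (E4.basisVector 0) 0| ≤ γ} ×ˢ
    (({T : E4 →L[ℝ] E4 | ∀ u w : E4, Minkowski.bilin (T u) w + Minkowski.bilin u (T w) = 0} ∩
      closedBall 0 C) ×ˢ closedBall 0 C)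
  have h𝒦c : IsCompact 𝒦 := (isCompact_lorentzBounded γ).prod
    (((isCompact_closedBall 0 C).inter_left coerSym_isClosed_skew).prod (isCompact_closedBall 0 C))
  have hu𝒦 : ∀ n, ((((Λ n : E4 ≃L[ℝ] E4).symm : E4 →L[ℝ] E4)), A n, d n) ∈ 𝒦 := fun n ↦
    ⟨coerSym_symm_mem_lorentzBounded (Λ n) (hΛ n), ⟨hA n, mem_closedBall_zero_iff.2 (hAC n)⟩,
      mem_closedBall_zero_iff.2 (hdC n)⟩
  obtain ⟨⟨S₀, A₀, d₀⟩, hp, φ, hφ, hlim⟩ :=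
    h𝒦c.tendsto_subseq (x := fun n ↦ ((((Λ n : E4 ≃L[ℝ] E4).symm : E4 →L[ℝ] E4)), A n, d n)) hu𝒦
  obtain ⟨hpS, ⟨hpA, -⟩, -⟩ := hp
  obtain ⟨Λs, hΛs, hΛsγ⟩ := coerSym_lorentz_of_mem_lorentzBounded hpS
  subst hΛs
  have hS' := hlim.fst_nhds
  have hA' := hlim.snd_nhds.fst_nhds
  have hd' := hlim.snd_nhds.snd_nhds
  have hεφ := hε.comp hφ.tendsto_atTop
  -- the reduced size of the limit is `1`
  have hred1 : (‖A₀ (E4.basisVector 0)‖ + ‖E4.spatial d₀‖ + ‖a • A₀ (E4.basisVector 3)‖) = 1 := by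
    have h1 := ((coerSym_continuous_red a).tendsto (A₀, d₀)).comp (hA'.prodMk_nhds hd')
    have h2 : Tendsto (fun n ↦ (‖(A (φ n)) (E4.basisVector 0)‖ + ‖E4.spatial (d (φ n))‖ + ‖a • (A (φ n)) (E4.basisVector 3)‖)) atTop (𝓝 1) := by
      have hf : (fun n ↦ (‖(A (φ n)) (E4.basisVector 0)‖ + ‖E4.spatial (d (φ n))‖ + ‖a • (A (φ n)) (E4.basisVector 3)‖)) = fun _ ↦ (1 : ℝ) := funext fun n ↦ hred (φ n)
      rw [hf]; exact tendsto_const_nhds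
    exact tendsto_nhds_unique h1 h2
  -- the symbol rows of the limit vanish on the whole shell
  have hvan : ∀ y : E3, ρin ≤ ‖y‖ → ‖y‖ ≤ ρout → ∀ Y Z : E4,
      (E4.dx 0 Z * E4.dx 0 (ContinuousLinearMap.inverse (boostedKerrBilin Λs 0 M a (E4.ofTimeSpace 0 y)) (ContinuousLinearMap.flip (ContinuousLinearMap.bilinearComp (fderiv ℝ (Kerr.bilin M a) ((((Λs : E4 ≃L[ℝ] E4).symm : E4 →L[ℝ] E4)) (E4.ofTimeSpace 0 y)) (A₀ ((((Λs : E4 ≃L[ℝ] E4).symm : E4 →L[ℝ] E4)) (E4.ofTimeSpace 0 y)) + d₀)) (((Λs : E4 ≃L[ℝ] E4).symm : E4 →L[ℝ] E4)) (((Λs : E4 ≃L[ℝ] E4).symm : E4 →L[ℝ] E4)) + ContinuousLinearMap.bilinearComp (Kerr.bilin M a ((((Λs : E4 ≃L[ℝ] E4).symm : E4 →L[ℝ] E4)) (E4.ofTimeSpace 0 y))) (ContinuousLinearMap.comp A₀ (((Λs : E4 ≃L[ℝ] E4).symm : E4 →L[ℝ] E4))) (((Λs : E4 ≃L[ℝ]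 E4).symm : E4 →L[ℝ] E4)) + ContinuousLinearMap.bilinearComp (Kerr.bilin M a ((((Λs : E4 ≃L[ℝ] E4).symm : E4 →L[ℝ] E4)) (E4.ofTimeSpace 0 y))) (((Λs : E4 ≃L[ℝ] E4).symm : E4 →L[ℝ] E4)) (ContinuousLinearMap.comp A₀ (((Λs : E4 ≃L[ℝ] E4).symm : E4 →L[ℝ] E4)))) Y)) + E4.dx 0 Y * (ContinuousLinearMap.bilinearComp (fderiv ℝ (Kerr.bilin M a) ((((Λs : E4 ≃L[ℝ] E4).symm : E4 →L[ℝ] E4)) (E4.ofTimeSpace 0 y)) (A₀ ((((Λs : E4 ≃L[ℝ] E4).symm : E4 →L[ℝ] E4)) (E4.ofTimeSpace 0 y)) + d₀)) (((Λs : E4 ≃L[ℝ] E4).symm : E4 →L[ℝ] E4)) (((Λs : E4 ≃L[ℝ] E4).symm : E4 →L[ℝ] E4)) + ContinuousLinearMap.bilinearComp (Kerr.bilin M a ((((Λs : E4 ≃L[ℝ] E4).symm : E4 →L[ℝ] E4)) (E4.ofTimeSpace 0 y))) (ContinuousLinearMap.comp A₀ (((Λs : E4 ≃L[ℝ] E4).symm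 : E4 →L[ℝ] E4))) (((Λs : E4 ≃L[ℝ] E4).symm : E4 →L[ℝ] E4)) + ContinuousLinearMap.bilinearComp (Kerr.bilin M a ((((Λs : E4 ≃L[ℝ] E4).symm : E4 →L[ℝ] E4)) (E4.ofTimeSpace 0 y))) (((Λs : E4 ≃L[ℝ] E4).symm : E4 →L[ℝ] E4)) (ContinuousLinearMap.comp A₀ (((Λs : E4 ≃L[ℝ] E4).symm : E4 →L[ℝ] E4)))) (ContinuousLinearMap.inverse (boostedKerrBilin Λs 0 M a (E4.ofTimeSpace 0 y)) (E4.dx 0)) Z - E4.dx 0 (ContinuousLinearMap.inverse (boostedKerrBilin Λs 0 M a (E4.ofTimeSpace 0 y)) (E4.dx 0)) * (ContinuousLinearMap.bilinearComp (fderiv ℝ (Kerr.bilin M a) ((((Λs : E4 ≃L[ℝ] E4).symm : E4 →L[ℝ] E4)) (E4.ofTimeSpace 0 y)) (A₀ ((((Λs : E4 ≃L[ℝ] E4).symm : E4 →L[ℝ] E4)) (E4.ofTimeSpace 0 y)) + d₀)) (((Λs : E4 ≃L[ℝ] E4).symm : E4 →L[ℝ] E4)) (((Λs : E4 ≃L[ℝ]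 E4).symm : E4 →L[ℝ] E4)) + ContinuousLinearMap.bilinearComp (Kerr.bilin M a ((((Λs : E4 ≃L[ℝ] E4).symm : E4 →L[ℝ] E4)) (E4.ofTimeSpace 0 y))) (ContinuousLinearMap.comp A₀ (((Λs : E4 ≃L[ℝ] E4).symm : E4 →L[ℝ] E4))) (((Λs : E4 ≃L[ℝ] E4).symm : E4 →L[ℝ] E4)) + ContinuousLinearMap.bilinearComp (Kerr.bilin M a ((((Λs : E4 ≃L[ℝ] E4).symm : E4 →L[ℝ] E4)) (E4.ofTimeSpace 0 y))) (((Λs : E4 ≃L[ℝ] E4).symm : E4 →L[ℝ] E4)) (ContinuousLinearMap.comp A₀ (((Λs : E4 ≃L[ℝ] E4).symm : E4 →L[ℝ] E4)))) Y Z - E4.dx 0 Y * E4.dx 0 Z * MetricCoord.traceCLM E4 (ContinuousLinearMap.comp (ContinuousLinearMap.inverse (boostedKerrBilin Λs 0 M a (E4.ofTimeSpace 0 y))) (ContinuousLinearMap.flip (ContinuousLinearMap.bilinearComp (fderiv ℝ (Kerr.bilin M a) ((((Λs : E4 ≃L[ℝ] E4).symm : E4 →L[ℝ] E4)) (E4.ofTimeSpace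 0 y)) (A₀ ((((Λs : E4 ≃L[ℝ] E4).symm : E4 →L[ℝ] E4)) (E4.ofTimeSpace 0 y)) + d₀)) (((Λs : E4 ≃L[ℝ] E4).symm : E4 →L[ℝ] E4)) (((Λs : E4 ≃L[ℝ] E4).symm : E4 →L[ℝ] E4)) + ContinuousLinearMap.bilinearComp (Kerr.bilin M a ((((Λs : E4 ≃L[ℝ] E4).symm : E4 →L[ℝ] E4)) (E4.ofTimeSpace 0 y))) (ContinuousLinearMap.comp A₀ (((Λs : E4 ≃L[ℝ] E4).symm : E4 →L[ℝ] E4))) (((Λs : E4 ≃L[ℝ] E4).symm : E4 →L[ℝ] E4)) + ContinuousLinearMap.bilinearComp (Kerr.bilin M a ((((Λs : E4 ≃L[ℝ] E4).symm : E4 →L[ℝ] E4)) (E4.ofTimeSpace 0 y))) (((Λs : E4 ≃L[ℝ] E4).symm : E4 →L[ℝ] E4)) (ContinuousLinearMap.comp A₀ (((Λs : E4 ≃L[ℝ] E4).symm : E4 →L[ℝ] E4))))))) = 0 := by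
    intro y hy1 hy2 Y Z
    have hrad : 0 < Kerr.radius a ((((Λs : E4 ≃L[ℝ] E4).symm : E4 →L[ℝ] E4)) (E4.ofTimeSpace 0 y)) :=
      lt_of_lt_of_le one_pos (coerSym_le_radius_symm Λs a zero_le_one (y := y) (by linarith)).1
    have hradp : 0 < Kerr.radius a (poincareInv Λs 0 (E4.ofTimeSpace 0 y)) := by rwa [coerSym_poincareInv_zero]
    have hinv : (boostedKerrBilin Λs 0 M a (E4.ofTimeSpace 0 y)).IsInvertible :=
      coerSym_isInvertible_boostedKerrBilin hradp
    have hcont := coerSym_continuousAt_symbol M a (E4.ofTimeSpace 0 y) Y Z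
      (boostedKerrBilin Λs 0 M a (E4.ofTimeSpace 0 y), (((Λs : E4 ≃L[ℝ] E4).symm : E4 →L[ℝ] E4)), A₀, d₀) hinv hrad
    have hK : Tendsto (fun n ↦ boostedKerrBilin (Λ (φ n)) 0 M a (E4.ofTimeSpace 0 y)) atTop
        (𝓝 (boostedKerrBilin Λs 0 M a (E4.ofTimeSpace 0 y))) := by
      have h := (coerSym_continuousAt_K M a (E4.ofTimeSpace 0 y) _ hrad).tendsto.comp hS'
      rw [coerSym_boostedKerrBilin_eq Λs]
      refine h.congr' (Eventually.of_forall fun n ↦ ?_)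
      exact (coerSym_boostedKerrBilin_eq (Λ (φ n)) M a (E4.ofTimeSpace 0 y)).symm
    have hBq : Tendsto (fun n ↦ B (φ n) y) atTop (𝓝 (boostedKerrBilin Λs 0 M a (E4.ofTimeSpace 0 y))) := by
      have hdiff : Tendsto (fun n ↦ B (φ n) y - boostedKerrBilin (Λ (φ n)) 0 M a (E4.ofTimeSpace 0 y)) atTop
          (𝓝 0) := squeeze_zero_norm (fun n ↦ hB (φ n) y hy1 hy2) hεφ
      have h := hdiff.add hK
      simpa using h
    have hq := hBq.prodMk_nhds (hS'.prodMk_nhds (hA'.prodMk_nhds hd'))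
    have hlim1 := hcont.tendsto.comp hq
    have hlim0 : Tendsto ((fun p : (E4 →L[ℝ] E4 →L[ℝ] ℝ) × (E4 →L[ℝ] E4) × (E4 →L[ℝ] E4) × E4 ↦
        (E4.dx 0 Z * E4.dx 0 (ContinuousLinearMap.inverse p.1 (ContinuousLinearMap.flip (ContinuousLinearMap.bilinearComp (fderiv ℝ (Kerr.bilin M a) (p.2.1 (E4.ofTimeSpace 0 y)) (p.2.2.1 (p.2.1 (E4.ofTimeSpace 0 y)) + p.2.2.2)) p.2.1 p.2.1 + ContinuousLinearMap.bilinearComp (Kerr.bilin M a (p.2.1 (E4.ofTimeSpace 0 y))) (ContinuousLinearMap.comp p.2.2.1 p.2.1) p.2.1 + ContinuousLinearMap.bilinearComp (Kerr.bilin M a (p.2.1 (E4.ofTimeSpace 0 y))) p.2.1 (ContinuousLinearMap.comp p.2.2.1 p.2.1)) Y)) + E4.dx 0 Y * (ContinuousLinearMap.bilinearComp (fderiv ℝ (Kerr.bilin M a) (p.2.1 (E4.ofTimeSpace 0 y)) (p.2.2.1 (p.2.1 (E4.ofTimeSpace 0 y)) + p.2.2.2)) p.2.1 p.2.1 + ContinuousLinearMap.bilinearComp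 (Kerr.bilin M a (p.2.1 (E4.ofTimeSpace 0 y))) (ContinuousLinearMap.comp p.2.2.1 p.2.1) p.2.1 + ContinuousLinearMap.bilinearComp (Kerr.bilin M a (p.2.1 (E4.ofTimeSpace 0 y))) p.2.1 (ContinuousLinearMap.comp p.2.2.1 p.2.1)) (ContinuousLinearMap.inverse p.1 (E4.dx 0)) Z - E4.dx 0 (ContinuousLinearMap.inverse p.1 (E4.dx 0)) * (ContinuousLinearMap.bilinearComp (fderiv ℝ (Kerr.bilin M a) (p.2.1 (E4.ofTimeSpace 0 y)) (p.2.2.1 (p.2.1 (E4.ofTimeSpace 0 y)) + p.2.2.2)) p.2.1 p.2.1 + ContinuousLinearMap.bilinearComp (Kerr.bilin M a (p.2.1 (E4.ofTimeSpace 0 y))) (ContinuousLinearMap.comp p.2.2.1 p.2.1) p.2.1 + ContinuousLinearMap.bilinearComp (Kerr.bilin M a (p.2.1 (E4.ofTimeSpace 0 y))) p.2.1 (ContinuousLinearMap.comp p.2.2.1 p.2.1)) Y Z - E4.dx 0 Y * E4.dx 0 Z * MetricCoord.traceCLM E4 (ContinuousLinearMap.comp (ContinuousLinearMap.inverse p.1)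 (ContinuousLinearMap.flip (ContinuousLinearMap.bilinearComp (fderiv ℝ (Kerr.bilin M a) (p.2.1 (E4.ofTimeSpace 0 y)) (p.2.2.1 (p.2.1 (E4.ofTimeSpace 0 y)) + p.2.2.2)) p.2.1 p.2.1 + ContinuousLinearMap.bilinearComp (Kerr.bilin M a (p.2.1 (E4.ofTimeSpace 0 y))) (ContinuousLinearMap.comp p.2.2.1 p.2.1) p.2.1 + ContinuousLinearMap.bilinearComp (Kerr.bilin M a (p.2.1 (E4.ofTimeSpace 0 y))) p.2.1 (ContinuousLinearMap.comp p.2.2.1 p.2.1)))))) ∘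
        (fun n ↦ (B (φ n) y, (((Λ (φ n) : E4 ≃L[ℝ] E4).symm : E4 →L[ℝ] E4)), A (φ n), d (φ n))))
        atTop (𝓝 0) := by
      refine squeeze_zero_norm (fun n ↦ ?_) (by simpa using hεφ.mul_const (‖Y‖ * ‖Z‖))
      rw [Real.norm_eq_abs]
      exact (hσ (φ n) y hy1 hy2 Y Z).trans_eq (mul_assoc _ _ _)
    exact tendsto_nhds_unique hlim1 hlim0
  -- the kernel step at the three lab axis events
  set v₃ : ℝ := ((Λs : E4 ≃L[ℝ] E4) (E4.basisVector 3)) 0 / ((Λs : E4 ≃L[ℝ] E4) (E4.basisVector 0)) 0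
  have hv : |v₃| < 1 := coerSym_abs_v3_lt_one Λs
  have hker := coerSym_axisKernel_of_symbol (Λ := Λs) hM hpA d₀ hz hza hv
    (WithLp.toLp 2 ![-(v₃ * z), 0, 0, z]) (WithLp.toLp 2 ![-(v₃ * (2 * z)), 0, 0, 2 * z])
    (WithLp.toLp 2 ![v₃ * z, 0, 0, -z]) rfl rfl rfl
    (fun x' ↦ (ContinuousLinearMap.bilinearComp (fderiv ℝ (Kerr.bilin M a) ((((Λs : E4 ≃L[ℝ] E4).symm : E4 →L[ℝ] E4)) x') (A₀ ((((Λs : E4 ≃L[ℝ] E4).symm : E4 →L[ℝ] E4)) x') + d₀)) (((Λs : E4 ≃L[ℝ] E4).symm : E4 →L[ℝ] E4)) (((Λs : E4 ≃L[ℝ] E4).symm : E4 →L[ℝ] E4)) + ContinuousLinearMap.bilinearComp (Kerr.bilin M a ((((Λs : E4 ≃L[ℝ] E4).symm : E4 →L[ℝ] E4)) x')) (ContinuousLinearMap.comp A₀ (((Λs : E4 ≃L[ℝ] E4).symm : E4 →L[ℝ] E4))) (((Λs : E4 ≃L[ℝ] E4).symm : E4 →L[ℝ] E4)) + ContinuousLinearMap.bilinearComp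 (Kerr.bilin M a ((((Λs : E4 ≃L[ℝ] E4).symm : E4 →L[ℝ] E4)) x')) (((Λs : E4 ≃L[ℝ] E4).symm : E4 →L[ℝ] E4)) (ContinuousLinearMap.comp A₀ (((Λs : E4 ≃L[ℝ] E4).symm : E4 →L[ℝ] E4)))))
    (fun x' ↦ boostedKerrBilin Λs 0 M a x') (fun x' v w ↦ by
      simp only [add_apply, ContinuousLinearMap.bilinearComp_apply, ContinuousLinearMap.comp_apply])
    (fun _ ↦ rfl) ?_
  · obtain ⟨hb, hd1, hd2, hd3, hax⟩ := hker
    have hsd : E4.spatial d₀ = 0 := by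
      ext i; fin_cases i
      · simpa using hd1
      · simpa using hd2
      · simpa using hd3
    have hae : a • A₀ (E4.basisVector 3) = 0 := by
      rcases eq_or_ne a 0 with rfl | ha
      · rw [zero_smul]
      · rw [hax ha, smul_zero]
    rw [hb, hsd, hae, norm_zero, norm_zero, add_zero, add_zero] at hred1
    exact zero_ne_one hred1
  · intro P hP
    have hPf : P 1 = 0 ∧ P 2 = 0 ∧ P 0 = -(v₃ * P 3) ∧ z ≤ |P 3| ∧ |P 3| ≤ 2 * z := by
      simp only [mem_insert_iff, mem_singleton_iff] at hP
      rcases hP with rfl | rfl | rfl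
      · have e3 : (WithLp.toLp 2 ![-(v₃ * z), 0, 0, z] : E4) 3 = z := rfl
        refine ⟨rfl, rfl, rfl, ?_, ?_⟩
        · rw [e3, abs_of_pos hz]
        · rw [e3, abs_of_pos hz]; linarith
      · have e3 : (WithLp.toLp 2 ![-(v₃ * (2 * z)), 0, 0, 2 * z] : E4) 3 = 2 * z := rfl
        refine ⟨rfl, rfl, rfl, ?_, ?_⟩
        · rw [e3, abs_of_pos (by linarith)]; linarith
        · rw [e3, abs_of_pos (by linarith)]
      · have e0 : (WithLp.toLp 2 ![v₃ * z, 0, 0, -z] : E4) 0 = v₃ * z := rfl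
        have e3 : (WithLp.toLp 2 ![v₃ * z, 0, 0, -z] : E4) 3 = -z := rfl
        refine ⟨rfl, rfl, ?_, ?_, ?_⟩
        · rw [e0, e3]; ring
        · rw [e3, abs_neg, abs_of_pos hz]
        · rw [e3, abs_neg, abs_of_pos hz]; linarith
    obtain ⟨h1, h2, h0, hz1, hz2⟩ := hPf
    obtain ⟨-, hxP, hlo, hhi⟩ := coerSym_axis_event Λs hΛsγ h1 h2 h0
    set yP : E3 := E4.spatial ((Λs : E4 ≃L[ℝ] E4) P)
    have h13 : 0 < 1 + 3 * γ := by linarith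
    have hy1 : ρin ≤ ‖yP‖ := le_of_mul_le_mul_left (by linarith) h13
    have hy2 : ‖yP‖ ≤ ρout := by
      have h := mul_le_mul_of_nonneg_left hz2 (by linarith : (0 : ℝ) ≤ 2 * (1 + 3 * γ))
      linarith
    refine ⟨MetricCoord.traceCLM E4 ((boostedKerrBilin Λs 0 M a ((Λs : E4 ≃L[ℝ] E4) P)).inverse.comp
      ((ContinuousLinearMap.bilinearComp (fderiv ℝ (Kerr.bilin M a) ((((Λs : E4 ≃L[ℝ] E4).symm : E4 →L[ℝ] E4)) ((Λs : E4 ≃L[ℝ] E4) P)) (A₀ ((((Λs : E4 ≃L[ℝ] E4).symm : E4 →L[ℝ] E4)) ((Λs : E4 ≃L[ℝ] E4) P)) + d₀)) (((Λs : E4 ≃L[ℝ] E4).symm : E4 →L[ℝ] E4)) (((Λs : E4 ≃L[ℝ] E4).symm : E4 →L[ℝ] E4)) + ContinuousLinearMap.bilinearComp (Kerr.bilin M a ((((Λs : E4 ≃L[ℝ] E4).symm : E4 →L[ℝ] E4)) ((Λs : E4 ≃L[ℝ] E4) P))) (ContinuousLinearMap.comp A₀ (((Λs : E4 ≃L[ℝ]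 E4).symm : E4 →L[ℝ] E4))) (((Λs : E4 ≃L[ℝ] E4).symm : E4 →L[ℝ] E4)) + ContinuousLinearMap.bilinearComp (Kerr.bilin M a ((((Λs : E4 ≃L[ℝ] E4).symm : E4 →L[ℝ] E4)) ((Λs : E4 ≃L[ℝ] E4) P))) (((Λs : E4 ≃L[ℝ] E4).symm : E4 →L[ℝ] E4)) (ContinuousLinearMap.comp A₀ (((Λs : E4 ≃L[ℝ] E4).symm : E4 →L[ℝ] E4))))).flip),
      fun Y Z ↦ ?_⟩
    have h := hvan yP hy1 hy2 Y Z
    rw [← hxP] at h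
    exact h

end Core

/-- **Registered one-line carrier form** (`coerSym_skewClosed_cs`, sub-goal of the crux item) of `coerSym_isClosed_skew`: the `η`-skew operators form a closed set (bookkeeping of the compactness argument). [folklore] -/
theorem coerSym_skewClosed_cs : open Literature.Geometry.Lorentzian in IsClosed {T : E4 →L[ℝ] E4 | ∀ u w : E4, Minkowski.bilin (T u) w + Minkowski.bilin u (T w) = 0} :=
  coerSym_isClosed_skew

end Summit.FinalStateConjecture.FinalStateConjecture.Theorems.SublinearIsFree.Slaving

end
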